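import Summits.FinalStateConjecture.FinalStateConjecture.Theorems.EIHFluxBalanceInertialRecessionSchwarzschildFrame
import Summits.FinalStateConjecture.FinalStateConjecture.Theorems.EIHFluxBalanceInertialRecessionLorentz
import Literature.Geometry.Lorentzian.MinkowskiCauchy
import Literature.Geometry.Lorentzian.BoostedKerrSchildDecay

/-!
# Route EIHFluxBalance — `InertialRecession`, re-charting: frame-free form of the painted
# Schwarzschild term (white-hole exclusion, algebra)

Helper file for the crux `stmt-FinalStateConjecture-10166`
(`Summit.FinalStateConjecture.FinalStateConjecture.Theses.EIHFluxBalance.InertialRecession`),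
stub `stub_rechart` of line `sublinear-is-free-clean-window-charges`.

The painted Schwarzschild reference field `boostedKerrBilin Λ c M 0` depends on the frame `Λ` only
through the 4-velocity `u = Λe₀` (spherical symmetry). This file makes that explicit for the
QUADRATIC values `g(x)(W, W)` WITHOUT any sign assumption on `u⁰` (so that it applies to
anti-orthochronous frames, i.e. painted WHITE holes): with `z = x − c`,

* `(Λ⁻¹z)⁰ = −η(z, u)`, `⟪(Λ⁻¹z)~, (Λ⁻¹w)~⟫ = η(z, w) + η(z, u)η(w, u)` (with the Literature
  lemma `lorentzGroup.minkowski_symm_apply`),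
  `r(x)² = η(z, u)² + η(z, z)` for the painted radius `r(x) = r₀(Λ⁻¹(x − c))`;
* `boostedKerrBilin_zero_spin_apply_self` — `g(x)(W, W) = η(W, W) + 2(M/r) ℓ²` with
  `ℓ = −η(W, u) + (η(z, W) + η(z, u)η(W, u))/r` (off the painted axis `r ≠ 0`);
* `frozen_values` — for the boosted data `u∞ = −Λ_V e₀`, `W₀ = Λ_V(1, ½n̂)`, `z̃ = Λ_V(ζ, ρn̂)`
  (`‖n̂‖ = 1`, `ρ > 0`): `η(W₀, W₀) = −3/4`, `η(W₀, u∞) = 1`, `η(z̃, u∞) = ζ`, `η(z̃, z̃) = ρ² − ζ²`,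
  `η(z̃, W₀) = ρ/2 − ζ`; hence painted radius `ρ` and `ℓ = −1/2`: the escape direction `W₀`
  (radially outgoing at half light speed in the frame of a TIME-REVERSED boosted hole) has model
  value `−3/4 + M/(2ρ) < 0` for `ρ > 2M/3`.

[Kerr–Schild 1965, §2 (Lorentz covariance); O'Neill 1983, Ch. 9, pp. 233–236; folklore]
-/

noncomputable section

set_option linter.dupNamespace false

open scoped InnerProductSpace
open Set Function Literature.Geometry.Lorentzian

namespace Summit.FinalStateConjecture.FinalStateConjecture.Theorems

/-! ### `Λ⁻¹` in terms of `η` and `u = Λe₀` -/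

/-- `(Λ⁻¹z)⁰ = −η(z, Λe₀)` (invariance of `η`; O'Neill 1983, Ch. 9, p. 233). [folklore] -/
theorem lorentz_symm_apply_zero (Λ : lorentzGroup) (z : E4) :
    ((Λ : E4 ≃L[ℝ] E4).symm z) 0 =
      -Minkowski.bilin z ((Λ : E4 ≃L[ℝ] E4) (E4.basisVector 0)) := by
  have h1 := minkowski_bilin_basisVector_zero_left ((Λ : E4 ≃L[ℝ] E4).symm z)
  have h3 := Λ.2 (E4.basisVector 0) ((Λ : E4 ≃L[ℝ] E4).symm z)
  rw [ContinuousLinearEquiv.apply_symm_apply, Minkowski.bilin_symm] at h3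
  linarith

/-- `⟪(Λ⁻¹z)~, (Λ⁻¹w)~⟫ = η(z, w) + η(z, u)η(w, u)`, `u = Λe₀`. [folklore] -/
theorem inner_spatial_symm_symm (Λ : lorentzGroup) (z w : E4) :
    inner ℝ (E4.spatial ((Λ : E4 ≃L[ℝ] E4).symm z)) (E4.spatial ((Λ : E4 ≃L[ℝ] E4).symm w)) =
      Minkowski.bilin z w + Minkowski.bilin z ((Λ : E4 ≃L[ℝ] E4) (E4.basisVector 0)) *
        Minkowski.bilin w ((Λ : E4 ≃L[ℝ] E4) (E4.basisVector 0)) := by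
  have h := Lorentz.minkowski_bilin_eq_inner ((Λ : E4 ≃L[ℝ] E4).symm z) ((Λ : E4 ≃L[ℝ] E4).symm w)
  rw [lorentzGroup.minkowski_symm_apply, lorentz_symm_apply_zero, lorentz_symm_apply_zero] at h
  linarith

/-- `‖(Λ⁻¹z)~‖² = η(z, u)² + η(z, z)`, `u = Λe₀`. [folklore] -/
theorem spatialNorm_symm_sq (Λ : lorentzGroup) (z : E4) :
    E4.spatialNorm ((Λ : E4 ≃L[ℝ] E4).symm z) ^ 2 =
      Minkowski.bilin z ((Λ : E4 ≃L[ℝ] E4) (E4.basisVector 0)) ^ 2 + Minkowski.bilin z z := by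
  have h := minkowski_bilin_self ((Λ : E4 ≃L[ℝ] E4).symm z)
  rw [lorentzGroup.minkowski_symm_apply, lorentz_symm_apply_zero] at h
  nlinarith

/-- **The painted radius is frame-free**: `r₀(Λ⁻¹(x − c))² = η(x − c, Λe₀)² + η(x − c, x − c)`.
[folklore] -/
theorem radius_poincareInv_zero_sq (Λ : lorentzGroup) (c x : E4) :
    Kerr.radius 0 (poincareInv Λ c x) ^ 2 =
      Minkowski.bilin (x - c) ((Λ : E4 ≃L[ℝ] E4) (E4.basisVector 0)) ^ 2 +
        Minkowski.bilin (x - c) (x - c) := by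
  rw [show Kerr.radius 0 (poincareInv Λ c x) = E4.spatialNorm ((Λ : E4 ≃L[ℝ] E4).symm (x - c)) by
    rw [Kerr.radius_zero_left]; rfl]
  exact spatialNorm_symm_sq Λ (x - c)

/-- The painted radius as a square root: `r₀(Λ⁻¹(x − c)) = √(η(x − c, u)² + η(x − c, x − c))`.
[folklore] -/
theorem radius_poincareInv_zero_eq_sqrt (Λ : lorentzGroup) (c x : E4) :
    Kerr.radius 0 (poincareInv Λ c x) =
      Real.sqrt (Minkowski.bilin (x - c) ((Λ : E4 ≃L[ℝ] E4) (E4.basisVector 0)) ^ 2 +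
        Minkowski.bilin (x - c) (x - c)) := by
  rw [← radius_poincareInv_zero_sq, Real.sqrt_sq (Kerr.radius_nonneg _ _)]

/-! ### The painted Schwarzschild value `g(x)(W, W)` in terms of `η` -/

/-- **Frame-free form of the painted Schwarzschild quadratic value.** Off the painted axis
(`r = r₀(Λ⁻¹(x − c)) ≠ 0`), with `z = x − c`, `u = Λe₀`:
`g_{Λ,c,M}(x)(W, W) = η(W, W) + 2(M/r)(−η(W, u) + (η(z, W) + η(z, u)η(W, u))/r)²`. No sign
condition on `u⁰`. Kerr–Schild 1965, §2. [folklore] -/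
theorem boostedKerrBilin_zero_spin_apply_self (Λ : lorentzGroup) (c : E4) (M : ℝ) (x W : E4)
    (hr : Kerr.radius 0 (poincareInv Λ c x) ≠ 0) :
    boostedKerrBilin Λ c M 0 x W W = Minkowski.bilin W W +
      2 * (M / Kerr.radius 0 (poincareInv Λ c x)) *
        (-Minkowski.bilin W ((Λ : E4 ≃L[ℝ] E4) (E4.basisVector 0)) +
          (Minkowski.bilin (x - c) W + Minkowski.bilin (x - c) ((Λ : E4 ≃L[ℝ] E4) (E4.basisVector 0)) *
            Minkowski.bilin W ((Λ : E4 ≃L[ℝ] E4) (E4.basisVector 0))) /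
            Kerr.radius 0 (poincareInv Λ c x)) ^ 2 := by
  set y : E4 := poincareInv Λ c x with hy
  have hyeq : y = (Λ : E4 ≃L[ℝ] E4).symm (x - c) := rfl
  have hrad : Kerr.radius 0 y = E4.spatialNorm y := Kerr.radius_zero_left y
  have hsn : E4.spatialNorm y ≠ 0 := by rwa [← hrad]
  rw [boostedKerrBilin_apply, kerr_bilin_apply_eq, ← hy, scalarH_zero_spin hsn,
    nullCovector_zero_spin_apply hsn, ← hrad]
  have h1 : Minkowski.bilin ((Λ : E4 ≃L[ℝ] E4).symm W) ((Λ : E4 ≃L[ℝ] E4).symm W) =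
      Minkowski.bilin W W := lorentzGroup.minkowski_symm_apply Λ W W
  have h2 : ((Λ : E4 ≃L[ℝ] E4).symm W) 0 =
      -Minkowski.bilin W ((Λ : E4 ≃L[ℝ] E4) (E4.basisVector 0)) := lorentz_symm_apply_zero Λ W
  have h3 : inner ℝ (E4.spatial y) (E4.spatial ((Λ : E4 ≃L[ℝ] E4).symm W)) =
      Minkowski.bilin (x - c) W + Minkowski.bilin (x - c) ((Λ : E4 ≃L[ℝ] E4) (E4.basisVector 0)) *
        Minkowski.bilin W ((Λ : E4 ≃L[ℝ] E4) (E4.basisVector 0)) := by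
    rw [hyeq]; exact inner_spatial_symm_symm Λ (x - c) W
  rw [h1, h2, h3]
  ring

/-! ### Minkowski products of boosted time/space vectors -/

/-- `η((a, p̄), (b, q̄)) = −ab + ⟪p̄, q̄⟫`. [folklore] -/
theorem minkowski_bilin_ofTimeSpace (a b : ℝ) (p q : E3) :
    Minkowski.bilin (E4.ofTimeSpace a p) (E4.ofTimeSpace b q) = -(a * b) + inner ℝ p q := by
  rw [Lorentz.minkowski_bilin_eq_inner, E4.ofTimeSpace_apply_zero, E4.ofTimeSpace_apply_zero,
    E4.spatial_ofTimeSpace, E4.spatial_ofTimeSpace]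

/-- `e₀ = (1, 0)`. [folklore] -/
theorem basisVector_zero_eq_ofTimeSpace : E4.basisVector 0 = E4.ofTimeSpace 1 (0 : E3) := by
  rw [E4.ofTimeSpace_eq_smul_add, one_smul]
  have : E4.ofTimeSpace 0 (0 : E3) = 0 := by
    rw [← E4.spaceEmbed_apply, map_zero]
  rw [this, add_zero]

/-- **The frozen values of the escape configuration.** In the frame of the boost `Λ_V`, with
`u∞ = −Λ_V e₀` (TIME-REVERSED 4-velocity), escape direction `W₀ = Λ_V(1, ½n̂)` and ray point
`z̃ = Λ_V(ζ, ρn̂)` (`‖n̂‖ = 1`): `η(W₀, W₀) = −3/4`, `η(W₀, u∞) = 1`, `η(z̃, u∞) = ζ`,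
`η(z̃, z̃) = ρ² − ζ²`, `η(z̃, W₀) = ρ/2 − ζ`. [folklore] -/
theorem frozen_values {V : E3} (hV : ‖V‖ < 1) {n : E3} (hn : ‖n‖ = 1) (ζ ρ : ℝ) :
    Minkowski.bilin (Lorentz.boostCLM V (E4.ofTimeSpace 1 ((1 / 2 : ℝ) • n)))
        (Lorentz.boostCLM V (E4.ofTimeSpace 1 ((1 / 2 : ℝ) • n))) = -(3 / 4) ∧
      Minkowski.bilin (Lorentz.boostCLM V (E4.ofTimeSpace 1 ((1 / 2 : ℝ) • n)))
        (-Lorentz.boostCLM V (E4.basisVector 0)) = 1 ∧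
      Minkowski.bilin (Lorentz.boostCLM V (E4.ofTimeSpace ζ (ρ • n)))
        (-Lorentz.boostCLM V (E4.basisVector 0)) = ζ ∧
      Minkowski.bilin (Lorentz.boostCLM V (E4.ofTimeSpace ζ (ρ • n)))
        (Lorentz.boostCLM V (E4.ofTimeSpace ζ (ρ • n))) = ρ ^ 2 - ζ ^ 2 ∧
      Minkowski.bilin (Lorentz.boostCLM V (E4.ofTimeSpace ζ (ρ • n)))
        (Lorentz.boostCLM V (E4.ofTimeSpace 1 ((1 / 2 : ℝ) • n))) = ρ / 2 - ζ := by
  have hnn : inner ℝ n n = 1 := by rw [real_inner_self_eq_norm_sq, hn, one_pow]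
  refine ⟨?_, ?_, ?_, ?_, ?_⟩
  · rw [Lorentz.minkowski_boostCLM hV, minkowski_bilin_ofTimeSpace, inner_smul_left,
      inner_smul_right, hnn]
    norm_num
  · rw [map_neg, Lorentz.minkowski_boostCLM hV, basisVector_zero_eq_ofTimeSpace,
      minkowski_bilin_ofTimeSpace, inner_zero_right]
    norm_num
  · rw [map_neg, Lorentz.minkowski_boostCLM hV, basisVector_zero_eq_ofTimeSpace,
      minkowski_bilin_ofTimeSpace, inner_zero_right]
    ring
  · rw [Lorentz.minkowski_boostCLM hV, minkowski_bilin_ofTimeSpace, inner_smul_left,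
      inner_smul_right, hnn]
    simp only [conj_trivial]
    ring
  · rw [Lorentz.minkowski_boostCLM hV, minkowski_bilin_ofTimeSpace, inner_smul_left,
      inner_smul_right, hnn]
    simp only [conj_trivial]
    ring

/-- **Frozen painted radius and frozen model value of the escape configuration**: with the products
of `frozen_values` and `ρ > 0`, the painted radius `√(η(z̃,u∞)² + η(z̃,z̃))` is `ρ` and the model
value `η(W₀,W₀) + 2(M/ρ)(−η(W₀,u∞) + (η(z̃,W₀) + η(z̃,u∞)η(W₀,u∞))/ρ)²` is `−3/4 + M/(2ρ)`.
[folklore] -/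
theorem frozen_radius_and_value {a b c d e ρ ζ M : ℝ} (hρ : 0 < ρ) (ha : a = -(3 / 4))
    (hb : b = 1) (hc : c = ζ) (hd : d = ρ ^ 2 - ζ ^ 2) (he : e = ρ / 2 - ζ) :
    Real.sqrt (c ^ 2 + d) = ρ ∧
      a + 2 * (M / Real.sqrt (c ^ 2 + d)) * (-b + (e + c * b) / Real.sqrt (c ^ 2 + d)) ^ 2 =
        -(3 / 4) + M / (2 * ρ) := by
  have hsq : Real.sqrt (c ^ 2 + d) = ρ := by
    rw [hc, hd, show ζ ^ 2 + (ρ ^ 2 - ζ ^ 2) = ρ ^ 2 by ring, Real.sqrt_sq hρ.le]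
  refine ⟨hsq, ?_⟩
  rw [hsq, ha, hb, hc, he]
  field_simp
  ring

/-- Registered one-line form (stub `lorentz_symm_apply_zero_rechart` of the crux item) of
`lorentz_symm_apply_zero`. [folklore] -/
theorem lorentz_symm_apply_zero_rechart : open Literature.Geometry.Lorentzian in ∀ (Λ : lorentzGroup) (z : E4), ((Λ : E4 ≃L[ℝ] E4).symm z) 0 = -Minkowski.bilin z ((Λ : E4 ≃L[ℝ] E4) (E4.basisVector 0)) :=
  fun Λ z ↦ lorentz_symm_apply_zero Λ z

end Summit.FinalStateConjecture.FinalStateConjecture.Theorems
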